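import Summits.FinalStateConjecture.FinalStateConjecture.Theorems.NearExtremalKappaCapture.Negative.ExponentMonotonicity
import Literature.Geometry.Lorentzian.Sweep2
import Literature.Geometry.Lorentzian.BlackHoles

/-!
# Corrected signatures, generation 2, for stubs 1/3 of line `polynomial-closure`
# (drefute g2, crux stmt-FinalStateConjecture-10606 `NearExtremalKappaCapture`)

Builds on the gen-1 correction (`Cruxes/NearExtremalKappaCapture/DrefuteCorrected.lean`:
horizon-PENETRATING chart `Kerr.region a r₀`, INHOMOGENEOUS law, equation off the axis and off
`{Δ = 0}`, smoothness demanded of the horizon-regular rescaled tensorised field) and repairs three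
further defects found in generation 2 (notes `Negative-notes/stub_polynomialClosing-g2.md`,
`Negative-notes/stub_kappaPolynomialTeukolskyLaw-g2.md`):

* (F2, parameter drift) the transfer's hypothesis must supply the linear law on a PARAMETER BOX
  around `(M, a)` — capture lands on `Kerr(M', a') ≠ Kerr(M, a)`, and a black-box ILED cannot be
  transported across a stationary (non-decaying) change of the Kerr parameters without a top-order
  derivative loss that nothing compensates (DHRT arXiv:2212.14093 closes top order with the DECAY of
  the perturbation; a frozen parameter shift does not decay). Every nonlinear proof in print invokes
  linear theory AT the final / modulated parameters. Hence `PolynomialClosingG2` assumes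
  `TeukolskySlabLawOn M' a' M' k w R Λ` for all `|M' − M| + |a' − a| ≤ Mχ/8` (a box that stays
  sub-extremal, with `χ/3 ≤ χ' ≤ 3χ`), and `C⁺` must then deliver ONE constant on the box: its `C(M, R)` is
  made LOCALLY UNIFORM in the mass (`M ∈ [M₀/2, 2M₀]`; true on paper by scaling up to the
  inhomogeneous weights `(1 + ‖y‖)^w`, which cost `max(M, M⁻¹)^{O(k+|w|)}` — locally bounded).
* (F3, slabs) the law is typed on SLABS `τ₀ ≤ t* ≤ τ₁` (DHRT (1.3) format) for fields smooth on an
  open neighbourhood of the closed slab, with NO support condition anywhere: the inequality lives in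
  `[0, ∞]`, so infinite initial energy makes it void, and an inner-edge support condition is not
  invariant under the evolution on the penetrating chart (matter reaches `r = r₀`), while a law
  anchored at `t* = 0` with `∫₀^∞` sources cannot be restarted inside a bootstrap without global
  linear solvability on a region of which `{t* = 0}` is not a Cauchy surface.
* (kept from gen 1) inner radius `r₀ := M'` (intrinsic; `r₋' < M' < r₊'`, red-shift `≥ 0` on
  `r ≥ M'`, no blue-shift region included), energies of `tensorise (rescale α)`.

Everything elaborates (`lean check` rc 0); the only `sorry`s are the two probes at the end.
-/

noncomputable section

namespace DrefuteG2Corrected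

open Literature.Geometry.Lorentzian Literature.Geometry.Lorentzian.Kerr
open Summit.FinalStateConjecture.FinalStateConjecture.Theorems.NearExtremalKappaCapture.Negative
open scoped Manifold ContDiff ENNReal
open Set MeasureTheory

/-- Complex `□_g` of `Kerr.metric M a r₀` on the chart domain `Kerr.region a r₀` (gen 1). -/
def cdalembertianOn [Facts] (M a r₀ : ℝ) [(metric M a r₀).HasLeviCivita] (α : region a r₀ → ℂ)
    (x : region a r₀) : ℂ :=
  ((metric M a r₀).toPseudoRiemannianMetric.dalembertian (fun y ↦ (α y).re) x : ℂ) +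
    Complex.I * ((metric M a r₀).toPseudoRiemannianMetric.dalembertian (fun y ↦ (α y).im) x : ℂ)

/-- Teukolsky's operator (4.7), verbatim `Kerr.teukolskyOp` but on `Kerr.region a r₀` (gen 1).
Junk on the axis and on `{Δ = 0}` (never imposed there). -/
def teukolskyOpOn [Facts] (M a r₀ : ℝ) [(metric M a r₀).HasLeviCivita] (s : ℤ)
    (α : region a r₀ → ℂ) (x : region a r₀) : ℂ :=
  ((radius a x.1 ^ 2 + a ^ 2 * cosTheta a x.1 ^ 2 : ℝ) : ℂ) * cdalembertianOn M a r₀ α x +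
    2 * (s : ℂ) * ((radius a x.1 - M : ℝ) : ℂ) * coordDeriv α x.1 (blRadialVector M a x.1) +
    2 * (s : ℂ) * (((a * (radius a x.1 - M) / delta M a (radius a x.1) : ℝ) : ℂ) +
        Complex.I * ((cosTheta a x.1 / sinTheta a x.1 ^ 2 : ℝ) : ℂ)) *
      coordDeriv α x.1 (blAxialVector x.1) +
    2 * (s : ℂ) * (((M * (radius a x.1 ^ 2 - a ^ 2) / delta M a (radius a x.1) - radius a x.1
          : ℝ) : ℂ) - Complex.I * ((a * cosTheta a x.1 : ℝ) : ℂ)) *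
      coordDeriv α x.1 (E4.basisVector 0) +
    ((s : ℂ) - (s : ℂ) ^ 2 * ((cosTheta a x.1 ^ 2 / sinTheta a x.1 ^ 2 : ℝ) : ℂ)) * α x

/-- Weighted `k`-th order energy of `α̃ m_s ⊗ m_s` through `{t* = τ} ∩ {r > r₀} ∩ {y ∈ A}` (gen 1). -/
def teukolskyEnergyOn (M a r₀ : ℝ) (s : ℤ) (α : region a r₀ → ℂ) (τ : ℝ) (k : ℕ) (p : ℝ)
    (A : Set E3) : ℝ≥0∞ :=
  sliceSobolevEnergy (region a r₀) (tensorise a s (rescale M a s α)) τ k p A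

/-- **Sourced spin-`s` Teukolsky pairs on a time slab of the penetrating chart** (g2): on the open
neighbourhood `U_θ = {τ₀ − θ < t* < τ₁ + θ}` of the closed slab, the horizon-regular rescaled
tensorised field `α̃ m_s ⊗ m_s` and the tensorised source extend to `C^∞` tensor fields (across the
axis AND across `{Δ = 0}`), and `𝔗^{[s]} α = F` holds off the axis and off `{Δ = 0}`. NO support or
decay condition: infinite weighted energies only make the law below void for that pair. -/
def IsTeukolskyPairOnSlab [Facts] (M a r₀ : ℝ) [(metric M a r₀).HasLeviCivita] (s : ℤ)
    (τ₀ τ₁ : ℝ) (α F : region a r₀ → ℂ) : Prop :=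
  ∃ θ : ℝ, 0 < θ ∧
    (∃ T : region a r₀ → Fin 4 → Fin 4 → ℂ,
      ContMDiffOn 𝓘(ℝ, E4) 𝓘(ℝ, Fin 4 → Fin 4 → ℂ) ∞ T
          {x | τ₀ - θ < (x : E4) 0 ∧ (x : E4) 0 < τ₁ + θ} ∧
        ∀ x : region a r₀, τ₀ - θ < (x : E4) 0 → (x : E4) 0 < τ₁ + θ → x.1 ∉ axis →
          delta M a (radius a x.1) ≠ 0 → T x = tensorise a s (rescale M a s α) x) ∧
    (∃ S : region a r₀ → Fin 4 → Fin 4 → ℂ,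
      ContMDiffOn 𝓘(ℝ, E4) 𝓘(ℝ, Fin 4 → Fin 4 → ℂ) ∞ S
          {x | τ₀ - θ < (x : E4) 0 ∧ (x : E4) 0 < τ₁ + θ} ∧
        ∀ x : region a r₀, τ₀ - θ < (x : E4) 0 → (x : E4) 0 < τ₁ + θ → x.1 ∉ axis →
          delta M a (radius a x.1) ≠ 0 → S x = tensorise a s (rescale M a s F) x) ∧
    ∀ x : region a r₀, τ₀ - θ < (x : E4) 0 → (x : E4) 0 < τ₁ + θ → x.1 ∉ axis →
      delta M a (radius a x.1) ≠ 0 → teukolskyOpOn M a r₀ s α x = F x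

/-- **The slab law (DHRT (1.3) format) at one `(M, a, r₀, k, w, R, Λ)`:** for every slab
`τ₀ ≤ τ₁` and every sourced pair on it, the first-order local energy through the top leaf plus its
time integral over the slab is at most `Λ ×` (weighted `k`-th order energy through the bottom leaf
+ time-integrated weighted `k`-th order energy of the source over the slab). -/
def TeukolskySlabLawOn [Facts] (M a r₀ : ℝ) (k : ℕ) (w R Λ : ℝ) : Prop :=
  ∀ [(metric M a r₀).HasLeviCivita], ∀ spin : ℤ, (spin = 2 ∨ spin = -2) →
    ∀ τ₀ τ₁ : ℝ, τ₀ ≤ τ₁ → ∀ α F : region a r₀ → ℂ, IsTeukolskyPairOnSlab M a r₀ spin τ₀ τ₁ α F →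
      teukolskyEnergyOn M a r₀ spin α τ₁ 1 0 (Metric.closedBall 0 R) +
          ∫⁻ τ in Ioo τ₀ τ₁, teukolskyEnergyOn M a r₀ spin α τ 1 0 (Metric.closedBall 0 R) ≤
        ENNReal.ofReal Λ * (teukolskyEnergyOn M a r₀ spin α τ₀ k w univ +
          ∫⁻ σ in Ioo τ₀ τ₁, teukolskyEnergyOn M a r₀ spin F σ k w univ)

/-- **Stub 1″ — `C⁺` retyped (g2):** slab law on the intrinsic chart `r₀ = M`, constant
`C χ^{−p}` with `C = C(M₀, R)` LOCALLY UNIFORM in the mass `M ∈ [M₀/2, 2M₀]`. -/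
def KappaPolynomialTeukolskySlabLaw : Prop :=
  ∀ [Facts], ∃ a₁ : ℝ, a₁ < 1 ∧ ∃ (p : ℝ) (k : ℕ) (w : ℝ), 0 ≤ p ∧
    ∀ M₀ : ℝ, 0 < M₀ → ∀ R : ℝ, ∃ C : ℝ, 1 ≤ C ∧ ∀ M : ℝ, M₀ / 2 ≤ M → M ≤ 2 * M₀ →
      ∀ a : ℝ, a₁ * M ≤ |a| → IsSubextremal M a →
        TeukolskySlabLawOn M a M k w R (C * (1 - (a / M) ^ 2) ^ (-p))

/-- Background bound at one spin (verbatim the skeleton's `BackgroundBoundAt`). -/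
def BackgroundBoundAt (M a : ℝ) (n : ℕ) (R B : ℝ) : Prop :=
  ∀ x : E4, x 0 = 0 → M ≤ radius a x → radius a x ≤ R → ∀ j : ℕ, j ≤ n →
    ‖iteratedFDeriv ℝ j (fun q : ℝ × E4 ↦ scalarH M q.1 q.2) (a, x)‖ ≤ B ∧
      ∀ μ : Fin 4, ‖iteratedFDeriv ℝ j (fun q : ℝ × E4 ↦ nullCovectorFun q.1 q.2 μ) (a, x)‖ ≤ B

/-- Capture at one spin (verbatim the skeleton's `CaptureAt` = the crux body at `(M, a)`). -/
def CaptureAt [Facts] [SliceFacts] (s : ℕ) (δ : ℝ) (k : ℕ) {M : ℝ} (hM : 0 < M)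
    (a ρ L : ℝ) : Prop :=
  ∀ (D : InitialDataSet 𝓘(ℝ, E3) (slice a M)) [D.metric.HasLeviCivita],
    D.IsVacuumConstraintSolution →
      InitialDataSet.dataWeightedSobolevEDist s δ D (data M a M hM.le) < ENNReal.ofReal ρ →
        ∀ 𝒟 : VacuumCauchyDevelopment D, 𝒟.IsMaximal →
          ∃ (M' a' : ℝ) (𝒟oc : Set 𝒟.carrier), IsSubextremal M' a' ∧ FarComplete 𝒟 ∧
            𝒟.toSpacetime.ConvergesToKerr 𝒟oc M' a' k ∧
              |M' - M| + |a' - a| ≤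
                L * √(InitialDataSet.dataWeightedSobolevEDist s δ D (data M a M hM.le)).toReal

/-- **Stub 3″ — the transfer retyped (g2):** hypothesis = the slab law with ONE constant `Λ` at
every parameter pair of the box `|M' − M| + |a' − a| ≤ Mχ/8` (inside it `|a'| < M'`,
`isSubextremal_of_box`, and `χ/3 ≤ χ' ≤ 3χ`), on each pair's own chart `Kerr.region a' M'`; background bound `B` at
`(M, a)` (the skeleton's `BackgroundUniform` covers the whole box anyway); conclusion verbatim. -/
def PolynomialClosingG2 : Prop :=
  ∀ [Facts] [SliceFacts], ∀ (k : ℕ) (w : ℝ),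
    ∃ (s : ℕ) (δ : ℝ) (kc : ℕ) (N : ℕ) (γ₀ : ℝ), ∀ (M : ℝ) (hM : 0 < M),
      ∃ (R : ℝ) (n : ℕ) (c₀ : ℝ), 0 < c₀ ∧ ∃ C₀ : ℝ, 0 ≤ C₀ ∧
        ∀ a : ℝ, IsSubextremal M a → ∀ Λ B : ℝ, 1 ≤ Λ → 1 ≤ B →
          (∀ M' a' : ℝ, |M' - M| + |a' - a| ≤ M * (1 - (a / M) ^ 2) / 8 →
              TeukolskySlabLawOn M' a' M' k w R Λ) →
            BackgroundBoundAt M a n R B →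
              CaptureAt s δ kc hM a (c₀ * (1 - (a / M) ^ 2) ^ γ₀ * ((Λ * B) ^ N)⁻¹)
                (C₀ * (1 - (a / M) ^ 2) ^ (-γ₀) * (Λ * B) ^ N)

/-! ### Sanity: the box stays sub-extremal; the class is non-empty; zero energies -/

/-- The parameter box of stub 3″ stays inside the sub-extremal family. -/
theorem isSubextremal_of_box {M a M' a' : ℝ} (h : IsSubextremal M a)
    (hbox : |M' - M| + |a' - a| ≤ M * (1 - (a / M) ^ 2) / 8) : IsSubextremal M' a' := by
  have hM : 0 < M := h.pos
  have ha : |a| < M := h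
  -- `M χ = (M - |a|)(M + |a|)/M ≤ 2 (M - |a|)`
  have hχ : M * (1 - (a / M) ^ 2) ≤ 2 * (M - |a|) := by
    have e : M * (1 - (a / M) ^ 2) = (M - |a|) * ((M + |a|) / M) := by
      field_simp
      rw [← sq_abs a]
      ring
    rw [e]
    have h2 : (M + |a|) / M ≤ 2 := by
      rw [div_le_iff₀ hM]; linarith
    have h0 : 0 ≤ M - |a| := by linarith
    nlinarith [mul_le_mul_of_nonneg_left h2 h0]
  have h1 : |M' - M| ≤ M * (1 - (a / M) ^ 2) / 8 := by linarith [abs_nonneg (a' - a)]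
  have h2 : |a' - a| ≤ M * (1 - (a / M) ^ 2) / 8 := by linarith [abs_nonneg (M' - M)]
  have h3 : |a'| ≤ |a| + |a' - a| := by
    calc |a'| = |a + (a' - a)| := by ring_nf
      _ ≤ |a| + |a' - a| := abs_add_le _ _
  have h4 : M - |M' - M| ≤ M' := by linarith [abs_sub_abs_le_abs_sub M' M, le_abs_self (M' - M), neg_abs_le (M' - M)]
  show |a'| < M'
  nlinarith [abs_nonneg (M' - M), abs_nonneg (a' - a)]

/-- The zero pair is a sourced pair on every slab (class non-empty). -/
example [Facts] (M a r₀ : ℝ) [(metric M a r₀).HasLeviCivita] (s : ℤ) (τ₀ τ₁ : ℝ) :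
    IsTeukolskyPairOnSlab M a r₀ s τ₀ τ₁ (fun _ ↦ 0) (fun _ ↦ 0) := by
  refine ⟨1, one_pos, ⟨fun _ ↦ 0, contMDiffOn_const, fun x _ _ _ _ ↦ by simp [rescale_zero]⟩,
    ⟨fun _ ↦ 0, contMDiffOn_const, fun x _ _ _ _ ↦ by simp [rescale_zero]⟩, fun x _ _ _ _ ↦ ?_⟩
  have h0 : Function.extend (Subtype.val : region a r₀ → E4) (fun _ ↦ (0 : ℂ)) (0 : E4 → ℂ)
      = 0 := by
    funext y
    classical
    rw [Function.extend_def]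
    split_ifs <;> rfl
  simp [teukolskyOpOn, cdalembertianOn, coordDeriv, h0, PseudoRiemannianMetric.dalembertian_const]

/-- Zero energies of the zero field: the slab law is consistent for every `Λ ≥ 0`. -/
example (M a r₀ : ℝ) (s : ℤ) (τ : ℝ) (k : ℕ) (p : ℝ) (A : Set E3) :
    teukolskyEnergyOn M a r₀ s (fun _ ↦ 0) τ k p A = 0 := by
  simp [teukolskyEnergyOn]

/-- Probe: stub 1″ elaborates. -/
theorem probe_stub1'' : KappaPolynomialTeukolskySlabLaw := by
  sorry

/-- Probe: stub 3″ elaborates. -/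
theorem probe_stub3'' : PolynomialClosingG2 := by
  sorry

end DrefuteG2Corrected

end
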